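import Mathlib
import Summits.Schanuel.Schanuel.Theses.RigidCore
import Summits.Schanuel.Schanuel.Theorems.RigidCoreMinimalCounterexampleInAclLogSector
import Summits.Schanuel.Schanuel.Theorems.RigidCoreMinimalCounterexampleInAclAclCriterion
import Summits.Schanuel.Schanuel.Theorems.RigidCoreMinimalCounterexampleInAclSelectorOneSided
import Summits.Schanuel.Schanuel.Theorems.RigidCoreMinimalCounterexampleInAclSelectorWindow
import Summits.Schanuel.Schanuel.Theorems.RigidCoreMinimalCounterexampleInAclMixedBridge
import Summits.Schanuel.Schanuel.Theorems.RigidCoreMinimalCounterexampleInAclGlTwoReduction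
import Summits.Schanuel.Schanuel.Theorems.RigidCoreMinimalCounterexampleInAclCosetBranchCover
import Summits.Schanuel.Schanuel.Theorems.RigidCoreMinimalCounterexampleInAclWindowRecurrenceCore
import Summits.Schanuel.Schanuel.Theorems.RigidCoreMinimalCounterexampleInAclWindowRigidityCoset

/-!
# (S*) at rank 2 on the MIXED SECTOR — crux stmt-Schanuel-0969 `RigidCore.MinimalCounterexampleInAcl`

Line `kernel-arithmetic-selection` (lead prover-line-stmt-Schanuel-0969-c3-0), `--supports stmt-Schanuel-0969`, registered stub
`stub_rankTwo_mixedSector`.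

**Theorem.** A rank-2 first-failure counterexample `x` to Schanuel's conjecture (`x` ℚ-linearly independent, `trdeg ℚ(x, eˣ) < 2`,
Hermite–Lindemann in rank 1) with SOME `e^{xᵢ}` transcendental and SOME non-zero integer combination `u = Σ Mᵢxᵢ` with `eᵘ`
algebraic has both coordinates in `acl^{ℂ_exp}(∅)` — UNCONDITIONALLY, although finiteness of its mates (the sibling crux
`SparsityTwo` on such curves, e.g. 0971's flagship root-chain atom) stays open.

Mechanism (card `Cruxes/MinimalCounterexampleInAcl/Ideas/torsor-self-selection.md`): `acl`-membership WITHOUT finiteness.  Pass to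
the primitive direction and transport along `GL₂(ℤ)` (`stub_glTwoReduction`) so that `e^{x₀} ∈ ℚ̄`; the `∅`-definable set
`E = {x'₀ : x' ∈ locusMates x}` lies on finitely many cosets of `2πiℤ` (`stub_mixedBridge`); `ℂ_exp` sees the order and arithmetic of
the integer parameter of each coset, so `x₀ ∈ acl(∅)` by the ONE-SIDED selector (`stub_selectorOneSided`) when the hit set of `x₀`'s
coset is finite, and by the WINDOW selector (`stub_selectorWindow`) otherwise, because long windows recur finitely often
(`stub_windowRecurrenceCore` over `stub_cosetBranchCover` and the divided-difference rigidity `stub_windowRigidity_coset`); the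
landed `acl`-field criterion `firstFailure_two_mem_expAcl_of_intCombo_mem` finishes.
-/

noncomputable section

set_option linter.dupNamespace false

open Complex Set FirstOrder Filter Topology Polynomial

namespace Summit.Schanuel.Schanuel.Cruxes.MinimalCounterexampleInAcl.KernelArithmeticSelection

open Literature.NumberTheory.Transcendental (SchanuelRank IsDefinedOver zariskiDim)
open Literature.ModelTheory.ExponentialFields
open Summit.Schanuel.Schanuel.Theorems.AclSubsetLogFreeCore.Negative

/-- Window recurrence is finite when `e^{x₀}` is algebraic (the geometric core applied to the two landed inputs). [folklore] -/
theorem windowRecurrence_e0 : ∀ (x : Fin 2 → ℂ), x ∈ firstFailures 2 → (∃ i, Transcendental ℚ (cexp (x i))) →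
    IsAlgebraic ℚ (cexp (x 0)) → ∃ L : ℕ, ∀ G : Finset ℤ, L ≤ G.card →
      Set.Finite {s : ℂ | ∀ g ∈ G, s + 2 * ↑Real.pi * I * (g : ℂ) ∈ {s : ℂ | ∃ x' ∈ locusMates x, s = x' 0}} :=
  fun x hx _ halg => stub_windowRecurrenceCore stub_windowRigidity_coset stub_cosetBranchCover x hx halg

/-- **(S*) AT RANK 2 WHEN `e^{x₀}` IS ALGEBRAIC** (off-log): bridge + one-sided selector if the hit set `K` of `x₀`'s coset is finite;
otherwise `K` contains windows of every length, which recur finitely often (`stub_windowRecurrence_e0`, also mirrored), and the window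
selector applies; either way `x₀ ∈ acl(∅)` and the landed criterion `firstFailure_two_mem_expAcl_of_intCombo_mem` finishes. -/
theorem rankTwo_mixed_e0 {x : Fin 2 → ℂ} (hx : x ∈ firstFailures 2) (hoff : ∃ i, Transcendental ℚ (cexp (x i)))
    (halg : IsAlgebraic ℚ (cexp (x 0))) : ∀ i, x i ∈ expAcl := by
  classical
  set E : Set ℂ := {s : ℂ | ∃ x' ∈ locusMates x, s = x' 0} with hE
  -- the bridge at `M = (1, 0)`
  have hsum : ∀ z : Fin 2 → ℂ, (∑ i, ((![1, 0] : Fin 2 → ℤ) i : ℂ) * z i) = z 0 := by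
    intro z; simp [Fin.sum_univ_two]
  have hEeq : {s : ℂ | ∃ x' ∈ locusMates x, s = ∑ i, ((![1, 0] : Fin 2 → ℤ) i : ℂ) * x' i} = E := by
    ext s; simp only [hE, Set.mem_setOf_eq, hsum]
  have halg' : IsAlgebraic ℚ (cexp (∑ i, ((![1, 0] : Fin 2 → ℤ) i : ℂ) * x i)) := by rwa [hsum]
  obtain ⟨hEdef, hEfin⟩ := stub_mixedBridge x ![1, 0] halg'
  rw [hEeq] at hEdef hEfin
  have huE : x 0 ∈ E := ⟨x, self_mem_locusMates x hx.1, rfl⟩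
  have hM : (![1, 0] : Fin 2 → ℤ) ≠ 0 := by
    intro h; have := congrFun h 0; simp at this
  refine firstFailure_two_mem_expAcl_of_intCombo_mem hx ![1, 0] hM ?_
  rw [hsum]
  set K : Set ℤ := {k : ℤ | x 0 + 2 * ↑Real.pi * I * (k : ℂ) ∈ E} with hK
  by_cases hKfin : K.Finite
  · exact stub_selectorOneSided E (x 0) hEdef hEfin huE (Or.inl hKfin.bddBelow)
  · obtain ⟨L, hL⟩ := windowRecurrence_e0 x hx hoff halg
    have hKinf : K.Infinite := hKfin
    obtain ⟨F, hFK, hFcard⟩ := hKinf.exists_subset_card_eq (L + 1)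
    have hFne : F.Nonempty := Finset.card_pos.1 (by omega)
    set k₀ : ℤ := F.min' hFne with hk₀
    set G : Finset ℤ := F.image (fun k => k - k₀) with hG
    have hk₀F : k₀ ∈ F := F.min'_mem hFne
    have h0G : (0 : ℤ) ∈ G := Finset.mem_image.2 ⟨k₀, hk₀F, sub_self _⟩
    have hGcard : G.card = F.card := Finset.card_image_of_injective _ sub_left_injective
    have hwin : ∀ g ∈ G, x 0 + 2 * ↑Real.pi * I * ((k₀ + g : ℤ) : ℂ) ∈ E := by
      intro g hg
      obtain ⟨k, hkF, rfl⟩ := Finset.mem_image.1 hg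
      have hk : k₀ + (k - k₀) = k := by ring
      rw [hk]
      exact hFK (Finset.mem_coe.2 hkF)
    have hfinP : Set.Finite {s : ℂ | ∀ g ∈ G, s + 2 * ↑Real.pi * I * (g : ℂ) ∈ E} :=
      hL G (by rw [hGcard, hFcard]; omega)
    have hfinN : Set.Finite {s : ℂ | ∀ g ∈ G, s - 2 * ↑Real.pi * I * (g : ℂ) ∈ E} := by
      have h := hL (G.image Neg.neg)
        (by rw [Finset.card_image_of_injective _ neg_injective, hGcard, hFcard]; omega)
      refine h.subset ?_
      intro s hs g hg
      obtain ⟨g', hg', rfl⟩ := Finset.mem_image.1 hg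
      have h' := hs g' hg'
      simp only [Int.cast_neg, mul_neg, ← sub_eq_add_neg]
      exact h'
    exact stub_selectorWindow E (x 0) G k₀ hEdef h0G hwin hfinP hfinN

/-- **(S*) AT RANK 2 ON THE MIXED SECTOR**: pass to the primitive direction `(a, b) = M / gcd` (its exponential is a root of `e^{Σ Mᵢxᵢ}`,
still algebraic), complete it to `GL₂(ℤ)` by Bézout, transport the first failure (`stub_glTwoReduction`) and apply `rankTwo_mixed_e0`. -/
theorem rankTwo_mixed {x : Fin 2 → ℂ} (hx : x ∈ firstFailures 2) (hoff : ∃ i, Transcendental ℚ (cexp (x i)))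
    (M : Fin 2 → ℤ) (hM : M ≠ 0) (halg : IsAlgebraic ℚ (cexp (∑ i, (M i : ℂ) * x i))) :
    ∀ i, x i ∈ expAcl := by
  classical
  -- the primitive direction
  set d : ℕ := Int.gcd (M 0) (M 1) with hd
  have hd0 : 0 < d := by
    rw [hd, Nat.pos_iff_ne_zero, Ne, Int.gcd_eq_zero_iff]
    rintro ⟨h0, h1⟩
    exact hM (funext fun i => by fin_cases i <;> assumption)
  set a : ℤ := M 0 / d with ha
  set b : ℤ := M 1 / d with hb
  have hMa : M 0 = a * d := (Int.ediv_mul_cancel (Int.gcd_dvd_left _ _)).symm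
  have hMb : M 1 = b * d := (Int.ediv_mul_cancel (Int.gcd_dvd_right _ _)).symm
  have hab : Int.gcd a b = 1 := Int.gcd_div_gcd_div_gcd hd0
  -- Bézout
  obtain ⟨u, v, hbez⟩ : ∃ u v : ℤ, a * u + b * v = 1 := by
    refine ⟨Int.gcdA a b, Int.gcdB a b, ?_⟩
    have h := Int.gcd_eq_gcd_ab a b
    rw [hab] at h
    push_cast at h
    linarith [h]
  -- the exponential of the primitive combination is algebraic
  have hpow : cexp ((a : ℂ) * x 0 + (b : ℂ) * x 1) ^ d = cexp (∑ i, (M i : ℂ) * x i) := by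
    rw [← Complex.exp_nat_mul, Fin.sum_univ_two, hMa, hMb]
    push_cast
    ring_nf
  have halg' : IsAlgebraic ℚ (cexp ((a : ℂ) * x 0 + (b : ℂ) * x 1)) :=
    IsAlgebraic.of_pow hd0 (by rw [hpow]; exact halg)
  -- transport
  obtain ⟨hx', hoff', hback⟩ := stub_glTwoReduction x a b u v hbez hx
  refine hback (rankTwo_mixed_e0 hx' (hoff' hoff) ?_)
  simpa using halg'


/-- **Registered stub `stub_rankTwo_mixedSector` (PROVED): (S*) at rank 2 on the mixed sector.** [folklore] -/
theorem stub_rankTwo_mixedSector : ∀ (x : Fin 2 → ℂ), x ∈ Summit.Schanuel.Schanuel.Cruxes.MinimalCounterexampleInAcl.KernelArithmeticSelection.firstFailures 2 → (∃ i, Transcendental ℚ (Complex.exp (x i))) → ∀ (M : Fin 2 → ℤ), M ≠ 0 → IsAlgebraic ℚ (Complex.exp (∑ i, (M i : ℂ) * x i)) → ∀ i, x i ∈ Summit.Schanuel.Schanuel.Theorems.AclSubsetLogFreeCore.Negative.expAcl :=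
  fun _ hx hoff M hM halg => rankTwo_mixed hx hoff M hM halg

end Summit.Schanuel.Schanuel.Cruxes.MinimalCounterexampleInAcl.KernelArithmeticSelection

end
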